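import Summits.KontsevichZagierPeriods.KontsevichZagierPeriods.Theorems.SoloInformedDefMoveDomainAdd
import HarnessLib

/-!
# First-order clauses of the Newton–Leibniz move (3)

The side conditions of the bounded Newton–Leibniz move (`soloInformedBddNewtonLeibnizRel`) between
parametrised terms — `T` (dimension `d + 1`, the integrand `g`), `T'` (dimension `d`, the
integrated term), and FUNCTION TERMS `W` (the primitive `F` on the fibre of `T`), `A`, `B` (the
bounds `a ≤ b` on the fibre of `T'`) — written as first-order clauses in the real parameter `p`
and proved `ℚ`-semialgebraic (Tarski–Seidenberg, block by block):

* `SoloInformedLeClause A B`        — `a ≤ b`;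
* `SoloInformedDomClause₁/₂ T A B`  — `D(T) = {(x, t) | x ∈ D(T'), a x ≤ t ≤ b x}`;
* `SoloInformedNLClause T' W A B`   — `g' x = F (x, b x) - F (x, a x)`;
* `SoloInformedContClause W A B`    — `t ↦ F (x, t)` continuous on `[a x, b x]` (ε–δ, 3 blocks);
* `SoloInformedDerivClause T W A B` — `t ↦ F (x, t)` has derivative `g (x, t)` on `(a x, b x)`
  (ε–δ, 3 blocks; absolute values replaced by squares).

Their meaning (the link with `ContinuousOn` / `HasDerivAt`) is established in the sequel.

References: [cite: KontsevichZagier2001, §1.2 rule (3)]; [cite: BochnakCosteRoy1998, Prop. 2.2.4].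
-/

noncomputable section

open Set MeasureTheory MvPolynomial Literature.ModelTheory.ExponentialFields
  Literature.NumberTheory.Transcendental

namespace Summit.KontsevichZagierPeriods.KontsevichZagierPeriods.Theorems

/-! ### Polynomial atoms -/

/-- `{u | u a ≤ u b}` is `ℚ`-semialgebraic. [cite: BochnakCosteRoy1998, Def. 2.1.4] -/
theorem soloInformed_isSemialgebraic_setOf_coord_le {ι : Type*} (a b : ι) :
    IsSemialgebraic ℚ {u : ι → ℝ | u a ≤ u b} := by
  simpa only [aeval_X] using
    isSemialgebraic_setOf_eval_le (k := ℚ) (R := ℝ) (X a : MvPolynomial ι ℚ) (X b)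

/-- `{u | (u a - u b)² < (u c)²}` is `ℚ`-semialgebraic. [cite: BochnakCosteRoy1998, Def. 2.1.4] -/
theorem soloInformed_isSemialgebraic_setOf_sq_sub_lt {ι : Type*} (a b c : ι) :
    IsSemialgebraic ℚ {u : ι → ℝ | (u a - u b) ^ 2 < u c ^ 2} := by
  have hset : {u : ι → ℝ | (u a - u b) ^ 2 < u c ^ 2} =
      {u | aeval u ((X a - X b) ^ 2 : MvPolynomial ι ℚ) <
        aeval u (X c ^ 2 : MvPolynomial ι ℚ)} := by
    ext u
    simp only [mem_setOf_eq, map_pow, map_sub, aeval_X]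
  rw [hset]
  exact isSemialgebraic_setOf_eval_lt _ _

/-- `{u | (u a - u b - u c·(u e - u f))² ≤ (u g)²·(u e - u f)²}` is `ℚ`-semialgebraic.
[cite: BochnakCosteRoy1998, Def. 2.1.4] -/
theorem soloInformed_isSemialgebraic_setOf_derivIneq {ι : Type*} (a b c e f g : ι) :
    IsSemialgebraic ℚ
      {u : ι → ℝ | (u a - u b - u c * (u e - u f)) ^ 2 ≤ u g ^ 2 * (u e - u f) ^ 2} := by
  have hset : {u : ι → ℝ | (u a - u b - u c * (u e - u f)) ^ 2 ≤ u g ^ 2 * (u e - u f) ^ 2} =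
      {u | aeval u ((X a - X b - X c * (X e - X f)) ^ 2 : MvPolynomial ι ℚ) ≤
        aeval u (X g ^ 2 * (X e - X f) ^ 2 : MvPolynomial ι ℚ)} := by
    ext u
    simp only [mem_setOf_eq, map_pow, map_sub, map_mul, aeval_X]
  rw [hset]
  exact isSemialgebraic_setOf_eval_le _ _

/-- `{u | u a = u b - u c}` is `ℚ`-semialgebraic. [cite: BochnakCosteRoy1998, Def. 2.1.4] -/
theorem soloInformed_isSemialgebraic_setOf_coord_eq_sub {ι : Type*} (a b c : ι) :
    IsSemialgebraic ℚ {u : ι → ℝ | u a = u b - u c} := by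
  have hset : {u : ι → ℝ | u a = u b - u c} =
      {u | aeval u (X a - X b + X c : MvPolynomial ι ℚ) = 0} := by
    ext u
    simp only [mem_setOf_eq, map_sub, map_add, aeval_X]
    constructor <;> intro h' <;> linarith
  rw [hset]
  exact isSemialgebraic_setOf_eval_eq_zero _

namespace SoloInformedPTerm

variable {K : Type} {d : ℕ}

/-! ### Index maps into the blocks `((p, x), w)` and `((((p, x), w), δ), y)` -/

/-- Fibre membership of `Fin.snoc x (w i)` for a term of dimension `d + 1`, read in the block
`((p, x), w)`. [cite: BochnakCosteRoy1998, §2.2] -/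
theorem comp_snocIdx_mem_fibre_iff {m : ℕ} (W : SoloInformedPTerm K (d + 1)) (p : K → ℝ)
    (x : Fin d → ℝ) (w : Fin m → ℝ) (i : Fin m) :
    Sum.elim (Sum.elim p x) w ∘ soloSnocIdx K d m i ∈ W.S ↔ Fin.snoc x (w i) ∈ W.fibre p := by
  rw [sumElim_comp_snocIdx]
  rfl

variable (K d) in
/-- The re-indexing realising `Fin.snoc (Fin.snoc x (w i)) (w j)` inside `((p, x), w)`.
[cite: BochnakCosteRoy1998, §2.2] -/
def soloSnocIdx₂ (m : ℕ) (i j : Fin m) : K ⊕ Fin (d + 2) → (K ⊕ Fin d) ⊕ Fin m :=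
  Sum.elim (fun k => Sum.inl (Sum.inl k))
    (Fin.snoc (Fin.snoc (fun l => Sum.inl (Sum.inr l)) (Sum.inr i)) (Sum.inr j))

/-- What `soloSnocIdx₂` does to the block `((p, x), w)`. [cite: BochnakCosteRoy1998, §2.2] -/
theorem sumElim_comp_soloSnocIdx₂ {m : ℕ} (p : K → ℝ) (x : Fin d → ℝ) (w : Fin m → ℝ)
    (i j : Fin m) : Sum.elim (Sum.elim p x) w ∘ soloSnocIdx₂ K d m i j =
      Sum.elim p (Fin.snoc (Fin.snoc x (w i)) (w j)) := by
  simp only [soloSnocIdx₂, Sum.comp_elim, Fin.comp_snoc]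
  rfl

/-- Graph membership of `((x, w i), w j)` for a term of dimension `d + 1`, read in the block
`((p, x), w)`. [cite: BochnakCosteRoy1998, §2.2] -/
theorem comp_snocIdx₂_mem_iff {m : ℕ} (W : SoloInformedPTerm K (d + 1)) (p : K → ℝ)
    (x : Fin d → ℝ) (w : Fin m → ℝ) (i j : Fin m) :
    Sum.elim (Sum.elim p x) w ∘ soloSnocIdx₂ K d m i j ∈ W.G ↔
      Fin.snoc (Fin.snoc x (w i)) (w j) ∈ W.gfibre p := by
  rw [sumElim_comp_soloSnocIdx₂]
  rfl

variable (K d) in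
/-- The re-indexing realising `((x, y i), y j)` inside `((((p, x), w), δ), y)`.
[cite: BochnakCosteRoy1998, §2.2] -/
def soloSnocIdx₄ (m m' : ℕ) (i j : Fin m') :
    K ⊕ Fin (d + 2) → (((K ⊕ Fin d) ⊕ Fin m) ⊕ Fin 1) ⊕ Fin m' :=
  Sum.elim (fun k => Sum.inl (Sum.inl (Sum.inl (Sum.inl k))))
    (Fin.snoc (Fin.snoc (fun l => Sum.inl (Sum.inl (Sum.inl (Sum.inr l)))) (Sum.inr i))
      (Sum.inr j))

variable (K d) in
/-- The re-indexing realising `((x, w i), y j)` inside `((((p, x), w), δ), y)`.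
[cite: BochnakCosteRoy1998, §2.2] -/
def soloSnocIdx₂₄ (m m' : ℕ) (i : Fin m) (j : Fin m') :
    K ⊕ Fin (d + 2) → (((K ⊕ Fin d) ⊕ Fin m) ⊕ Fin 1) ⊕ Fin m' :=
  Sum.elim (fun k => Sum.inl (Sum.inl (Sum.inl (Sum.inl k))))
    (Fin.snoc (Fin.snoc (fun l => Sum.inl (Sum.inl (Sum.inl (Sum.inr l))))
      (Sum.inl (Sum.inl (Sum.inr i)))) (Sum.inr j))

/-- Graph membership of `((x, y i), y j)` read in the deep block.
[cite: BochnakCosteRoy1998, §2.2] -/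
theorem comp_snocIdx₄_mem_iff {m m' : ℕ} (W : SoloInformedPTerm K (d + 1)) (p : K → ℝ)
    (x : Fin d → ℝ) (w : Fin m → ℝ) (δ : Fin 1 → ℝ) (y : Fin m' → ℝ) (i j : Fin m') :
    Sum.elim (Sum.elim (Sum.elim (Sum.elim p x) w) δ) y ∘ soloSnocIdx₄ K d m m' i j ∈ W.G ↔
      Fin.snoc (Fin.snoc x (y i)) (y j) ∈ W.gfibre p := by
  have h : Sum.elim (Sum.elim (Sum.elim (Sum.elim p x) w) δ) y ∘ soloSnocIdx₄ K d m m' i j =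
      Sum.elim p (Fin.snoc (Fin.snoc x (y i)) (y j)) := by
    simp only [soloSnocIdx₄, Sum.comp_elim, Fin.comp_snoc]
    rfl
  rw [h]
  rfl

/-- Graph membership of `((x, w i), y j)` read in the deep block.
[cite: BochnakCosteRoy1998, §2.2] -/
theorem comp_snocIdx₂₄_mem_iff {m m' : ℕ} (W : SoloInformedPTerm K (d + 1)) (p : K → ℝ)
    (x : Fin d → ℝ) (w : Fin m → ℝ) (δ : Fin 1 → ℝ) (y : Fin m' → ℝ) (i : Fin m) (j : Fin m') :
    Sum.elim (Sum.elim (Sum.elim (Sum.elim p x) w) δ) y ∘ soloSnocIdx₂₄ K d m m' i j ∈ W.G ↔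
      Fin.snoc (Fin.snoc x (w i)) (y j) ∈ W.gfibre p := by
  have h : Sum.elim (Sum.elim (Sum.elim (Sum.elim p x) w) δ) y ∘ soloSnocIdx₂₄ K d m m' i j =
      Sum.elim p (Fin.snoc (Fin.snoc x (w i)) (y j)) := by
    simp only [soloSnocIdx₂₄, Sum.comp_elim, Fin.comp_snoc]
    rfl
  rw [h]
  rfl

/-! ### The clause `a ≤ b` -/

/-- `a x ≤ b x` on the fibre of `A`, in block form. [cite: KontsevichZagier2001, §1.2 rule (3)] -/
def SoloInformedLeClause (A B : SoloInformedPTerm K d) (p : K → ℝ) : Prop :=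
  ∀ (x : Fin d → ℝ) (w : Fin 2 → ℝ), x ∈ A.fibre p → Fin.snoc x (w 0) ∈ A.gfibre p →
    Fin.snoc x (w 1) ∈ B.gfibre p → w 0 ≤ w 1

/-- The clause `a ≤ b` is `ℚ`-semialgebraic. [cite: BochnakCosteRoy1998, Prop. 2.2.4] -/
theorem isSemialgebraic_setOf_leClause [Finite K] (A B : SoloInformedPTerm K d) :
    IsSemialgebraic ℚ {p : K → ℝ | SoloInformedLeClause A B p} := by
  have hC : IsSemialgebraic ℚ {u : (K ⊕ Fin d) ⊕ Fin 2 → ℝ | u ∘ Sum.inl ∈ A.S →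
      u ∘ soloSnocIdx K d 2 0 ∈ A.G → u ∘ soloSnocIdx K d 2 1 ∈ B.G →
        u (Sum.inr 0) ≤ u (Sum.inr 1)} :=
    soloInformed_isSemialgebraic_setOf_imp (A.hS.preimage_comp _)
      (soloInformed_isSemialgebraic_setOf_imp (A.hG.preimage_comp _)
        (soloInformed_isSemialgebraic_setOf_imp (B.hG.preimage_comp _)
          (soloInformed_isSemialgebraic_setOf_coord_le _ _)))
  refine soloInformed_isSemialgebraic_setOf_forall_fibre
    (soloInformed_isSemialgebraic_setOf_forall_block hC fun _ => Iff.rfl) fun p x => ?_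
  simp only [mem_setOf_eq, Sum.elim_comp_inl, comp_snocIdx_mem_iff, Sum.elim_inr, mem_fibre]

/-! ### The domain clause `D(T) = {(x, t) | x ∈ D(A), a x ≤ t ≤ b x}` -/

/-- First half of the domain clause: points of `D(T)` lie over `D(A)` between the bounds.
[cite: KontsevichZagier2001, §1.2 rule (3)] -/
def SoloInformedDomClause₁ (T : SoloInformedPTerm K (d + 1)) (A B : SoloInformedPTerm K d)
    (p : K → ℝ) : Prop :=
  ∀ (x : Fin d → ℝ) (w : Fin 3 → ℝ), Fin.snoc x (w 0) ∈ T.fibre p →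
    x ∈ A.fibre p ∧ (Fin.snoc x (w 1) ∈ A.gfibre p → Fin.snoc x (w 2) ∈ B.gfibre p →
      w 1 ≤ w 0 ∧ w 0 ≤ w 2)

/-- Second half of the domain clause: points over `D(A)` between the bounds lie in `D(T)`.
[cite: KontsevichZagier2001, §1.2 rule (3)] -/
def SoloInformedDomClause₂ (T : SoloInformedPTerm K (d + 1)) (A B : SoloInformedPTerm K d)
    (p : K → ℝ) : Prop :=
  ∀ (x : Fin d → ℝ) (w : Fin 3 → ℝ), x ∈ A.fibre p → Fin.snoc x (w 1) ∈ A.gfibre p →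
    Fin.snoc x (w 2) ∈ B.gfibre p → w 1 ≤ w 0 → w 0 ≤ w 2 → Fin.snoc x (w 0) ∈ T.fibre p

/-- The first domain clause is `ℚ`-semialgebraic. [cite: BochnakCosteRoy1998, Prop. 2.2.4] -/
theorem isSemialgebraic_setOf_domClause₁ [Finite K] (T : SoloInformedPTerm K (d + 1))
    (A B : SoloInformedPTerm K d) :
    IsSemialgebraic ℚ {p : K → ℝ | SoloInformedDomClause₁ T A B p} := by
  have hC : IsSemialgebraic ℚ {u : (K ⊕ Fin d) ⊕ Fin 3 → ℝ | u ∘ soloSnocIdx K d 3 0 ∈ T.S →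
      u ∘ Sum.inl ∈ A.S ∧ (u ∘ soloSnocIdx K d 3 1 ∈ A.G → u ∘ soloSnocIdx K d 3 2 ∈ B.G →
        u (Sum.inr 1) ≤ u (Sum.inr 0) ∧ u (Sum.inr 0) ≤ u (Sum.inr 2))} :=
    soloInformed_isSemialgebraic_setOf_imp (T.hS.preimage_comp _)
      (soloInformed_isSemialgebraic_setOf_and (A.hS.preimage_comp _)
        (soloInformed_isSemialgebraic_setOf_imp (A.hG.preimage_comp _)
          (soloInformed_isSemialgebraic_setOf_imp (B.hG.preimage_comp _)
            (soloInformed_isSemialgebraic_setOf_and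
              (soloInformed_isSemialgebraic_setOf_coord_le _ _)
              (soloInformed_isSemialgebraic_setOf_coord_le _ _)))))
  refine soloInformed_isSemialgebraic_setOf_forall_fibre
    (soloInformed_isSemialgebraic_setOf_forall_block hC fun _ => Iff.rfl) fun p x => ?_
  simp only [mem_setOf_eq, Sum.elim_comp_inl, comp_snocIdx_mem_iff, comp_snocIdx_mem_fibre_iff,
    Sum.elim_inr, mem_fibre]

/-- The second domain clause is `ℚ`-semialgebraic. [cite: BochnakCosteRoy1998, Prop. 2.2.4] -/
theorem isSemialgebraic_setOf_domClause₂ [Finite K] (T : SoloInformedPTerm K (d + 1))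
    (A B : SoloInformedPTerm K d) :
    IsSemialgebraic ℚ {p : K → ℝ | SoloInformedDomClause₂ T A B p} := by
  have hC : IsSemialgebraic ℚ {u : (K ⊕ Fin d) ⊕ Fin 3 → ℝ | u ∘ Sum.inl ∈ A.S →
      u ∘ soloSnocIdx K d 3 1 ∈ A.G → u ∘ soloSnocIdx K d 3 2 ∈ B.G →
        u (Sum.inr 1) ≤ u (Sum.inr 0) → u (Sum.inr 0) ≤ u (Sum.inr 2) →
          u ∘ soloSnocIdx K d 3 0 ∈ T.S} :=
    soloInformed_isSemialgebraic_setOf_imp (A.hS.preimage_comp _)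
      (soloInformed_isSemialgebraic_setOf_imp (A.hG.preimage_comp _)
        (soloInformed_isSemialgebraic_setOf_imp (B.hG.preimage_comp _)
          (soloInformed_isSemialgebraic_setOf_imp (soloInformed_isSemialgebraic_setOf_coord_le _ _)
            (soloInformed_isSemialgebraic_setOf_imp
              (soloInformed_isSemialgebraic_setOf_coord_le _ _) (T.hS.preimage_comp _)))))
  refine soloInformed_isSemialgebraic_setOf_forall_fibre
    (soloInformed_isSemialgebraic_setOf_forall_block hC fun _ => Iff.rfl) fun p x => ?_
  simp only [mem_setOf_eq, Sum.elim_comp_inl, comp_snocIdx_mem_iff, comp_snocIdx_mem_fibre_iff,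
    Sum.elim_inr, mem_fibre]

/-! ### The Newton–Leibniz clause `g' x = F (x, b x) - F (x, a x)` -/

/-- The Newton–Leibniz clause in block form (`w = (a x, b x, F (x, a x), F (x, b x), g' x)`).
[cite: KontsevichZagier2001, §1.2 rule (3)] -/
def SoloInformedNLClause (T' : SoloInformedPTerm K d) (W : SoloInformedPTerm K (d + 1))
    (A B : SoloInformedPTerm K d) (p : K → ℝ) : Prop :=
  ∀ (x : Fin d → ℝ) (w : Fin 5 → ℝ), x ∈ T'.fibre p → Fin.snoc x (w 0) ∈ A.gfibre p →
    Fin.snoc x (w 1) ∈ B.gfibre p → Fin.snoc (Fin.snoc x (w 0)) (w 2) ∈ W.gfibre p →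
      Fin.snoc (Fin.snoc x (w 1)) (w 3) ∈ W.gfibre p → Fin.snoc x (w 4) ∈ T'.gfibre p →
        w 4 = w 3 - w 2

/-- The Newton–Leibniz clause is `ℚ`-semialgebraic. [cite: BochnakCosteRoy1998, Prop. 2.2.4] -/
theorem isSemialgebraic_setOf_nlClause [Finite K] (T' : SoloInformedPTerm K d)
    (W : SoloInformedPTerm K (d + 1)) (A B : SoloInformedPTerm K d) :
    IsSemialgebraic ℚ {p : K → ℝ | SoloInformedNLClause T' W A B p} := by
  have hC : IsSemialgebraic ℚ {u : (K ⊕ Fin d) ⊕ Fin 5 → ℝ | u ∘ Sum.inl ∈ T'.S →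
      u ∘ soloSnocIdx K d 5 0 ∈ A.G → u ∘ soloSnocIdx K d 5 1 ∈ B.G →
        u ∘ soloSnocIdx₂ K d 5 0 2 ∈ W.G → u ∘ soloSnocIdx₂ K d 5 1 3 ∈ W.G →
          u ∘ soloSnocIdx K d 5 4 ∈ T'.G → u (Sum.inr 4) = u (Sum.inr 3) - u (Sum.inr 2)} :=
    soloInformed_isSemialgebraic_setOf_imp (T'.hS.preimage_comp _)
      (soloInformed_isSemialgebraic_setOf_imp (A.hG.preimage_comp _)
        (soloInformed_isSemialgebraic_setOf_imp (B.hG.preimage_comp _)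
          (soloInformed_isSemialgebraic_setOf_imp (W.hG.preimage_comp _)
            (soloInformed_isSemialgebraic_setOf_imp (W.hG.preimage_comp _)
              (soloInformed_isSemialgebraic_setOf_imp (T'.hG.preimage_comp _)
                (soloInformed_isSemialgebraic_setOf_coord_eq_sub _ _ _))))))
  refine soloInformed_isSemialgebraic_setOf_forall_fibre
    (soloInformed_isSemialgebraic_setOf_forall_block hC fun _ => Iff.rfl) fun p x => ?_
  simp only [mem_setOf_eq, Sum.elim_comp_inl, comp_snocIdx_mem_iff, comp_snocIdx₂_mem_iff,
    Sum.elim_inr, mem_fibre]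

/-! ### The continuity clause (ε–δ, three blocks) -/

/-- Continuity of `t ↦ F (x, t)` on `[a x, b x]` for `x ∈ D(A)`, ε–δ in block form:
`w = (a x, b x, t₀, ε)`, `δ`, `y = (t, F (x, t), F (x, t₀))`; absolute values as squares.
[cite: KontsevichZagier2001, §1.2 rule (3)] -/
def SoloInformedContClause (W : SoloInformedPTerm K (d + 1)) (A B : SoloInformedPTerm K d)
    (p : K → ℝ) : Prop :=
  ∀ (x : Fin d → ℝ) (w : Fin 4 → ℝ), x ∈ A.fibre p → Fin.snoc x (w 0) ∈ A.gfibre p →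
    Fin.snoc x (w 1) ∈ B.gfibre p → w 0 ≤ w 2 → w 2 ≤ w 1 → 0 < w 3 →
      ∃ δ : Fin 1 → ℝ, 0 < δ 0 ∧ ∀ y : Fin 3 → ℝ, w 0 ≤ y 0 → y 0 ≤ w 1 →
        (y 0 - w 2) ^ 2 < δ 0 ^ 2 → Fin.snoc (Fin.snoc x (y 0)) (y 1) ∈ W.gfibre p →
          Fin.snoc (Fin.snoc x (w 2)) (y 2) ∈ W.gfibre p → (y 1 - y 2) ^ 2 < w 3 ^ 2

/-- **The continuity clause is `ℚ`-semialgebraic.** [cite: BochnakCosteRoy1998, Prop. 2.2.4] -/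
theorem isSemialgebraic_setOf_contClause [Finite K] (W : SoloInformedPTerm K (d + 1))
    (A B : SoloInformedPTerm K d) :
    IsSemialgebraic ℚ {p : K → ℝ | SoloInformedContClause W A B p} := by
  -- innermost block, variables `((((p, x), w), δ), y)`
  have hI : IsSemialgebraic ℚ {u : (((K ⊕ Fin d) ⊕ Fin 4) ⊕ Fin 1) ⊕ Fin 3 → ℝ |
      u (Sum.inl (Sum.inl (Sum.inr 0))) ≤ u (Sum.inr 0) →
      u (Sum.inr 0) ≤ u (Sum.inl (Sum.inl (Sum.inr 1))) →
      (u (Sum.inr 0) - u (Sum.inl (Sum.inl (Sum.inr 2)))) ^ 2 < u (Sum.inl (Sum.inr 0)) ^ 2 →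
      u ∘ soloSnocIdx₄ K d 4 3 0 1 ∈ W.G → u ∘ soloSnocIdx₂₄ K d 4 3 2 2 ∈ W.G →
      (u (Sum.inr 1) - u (Sum.inr 2)) ^ 2 < u (Sum.inl (Sum.inl (Sum.inr 3))) ^ 2} :=
    soloInformed_isSemialgebraic_setOf_imp (soloInformed_isSemialgebraic_setOf_coord_le _ _)
      (soloInformed_isSemialgebraic_setOf_imp (soloInformed_isSemialgebraic_setOf_coord_le _ _)
      (soloInformed_isSemialgebraic_setOf_imp (soloInformed_isSemialgebraic_setOf_sq_sub_lt _ _ _)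
      (soloInformed_isSemialgebraic_setOf_imp (W.hG.preimage_comp _)
      (soloInformed_isSemialgebraic_setOf_imp (W.hG.preimage_comp _)
      (soloInformed_isSemialgebraic_setOf_sq_sub_lt _ _ _)))))
  -- middle block `(((p, x), w), δ)`
  have hM : IsSemialgebraic ℚ {u : ((K ⊕ Fin d) ⊕ Fin 4) ⊕ Fin 1 → ℝ | 0 < u (Sum.inr 0) ∧
      ∀ y : Fin 3 → ℝ, Sum.elim u y ∈ {u : (((K ⊕ Fin d) ⊕ Fin 4) ⊕ Fin 1) ⊕ Fin 3 → ℝ |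
      u (Sum.inl (Sum.inl (Sum.inr 0))) ≤ u (Sum.inr 0) →
      u (Sum.inr 0) ≤ u (Sum.inl (Sum.inl (Sum.inr 1))) →
      (u (Sum.inr 0) - u (Sum.inl (Sum.inl (Sum.inr 2)))) ^ 2 < u (Sum.inl (Sum.inr 0)) ^ 2 →
      u ∘ soloSnocIdx₄ K d 4 3 0 1 ∈ W.G → u ∘ soloSnocIdx₂₄ K d 4 3 2 2 ∈ W.G →
      (u (Sum.inr 1) - u (Sum.inr 2)) ^ 2 < u (Sum.inl (Sum.inl (Sum.inr 3))) ^ 2}} :=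
    soloInformed_isSemialgebraic_setOf_and (soloInformed_isSemialgebraic_setOf_coord_pos _)
      (soloInformed_isSemialgebraic_setOf_forall_block hI fun _ => Iff.rfl)
  -- outer block `((p, x), w)`
  have hO : IsSemialgebraic ℚ {u : (K ⊕ Fin d) ⊕ Fin 4 → ℝ | u ∘ Sum.inl ∈ A.S →
      u ∘ soloSnocIdx K d 4 0 ∈ A.G → u ∘ soloSnocIdx K d 4 1 ∈ B.G →
      u (Sum.inr 0) ≤ u (Sum.inr 2) → u (Sum.inr 2) ≤ u (Sum.inr 1) → 0 < u (Sum.inr 3) →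
      ∃ δ : Fin 1 → ℝ, Sum.elim u δ ∈ {u : ((K ⊕ Fin d) ⊕ Fin 4) ⊕ Fin 1 → ℝ |
        0 < u (Sum.inr 0) ∧ ∀ y : Fin 3 → ℝ,
        Sum.elim u y ∈ {u : (((K ⊕ Fin d) ⊕ Fin 4) ⊕ Fin 1) ⊕ Fin 3 → ℝ |
      u (Sum.inl (Sum.inl (Sum.inr 0))) ≤ u (Sum.inr 0) →
      u (Sum.inr 0) ≤ u (Sum.inl (Sum.inl (Sum.inr 1))) →
      (u (Sum.inr 0) - u (Sum.inl (Sum.inl (Sum.inr 2)))) ^ 2 < u (Sum.inl (Sum.inr 0)) ^ 2 →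
      u ∘ soloSnocIdx₄ K d 4 3 0 1 ∈ W.G → u ∘ soloSnocIdx₂₄ K d 4 3 2 2 ∈ W.G →
      (u (Sum.inr 1) - u (Sum.inr 2)) ^ 2 < u (Sum.inl (Sum.inl (Sum.inr 3))) ^ 2}}} :=
    soloInformed_isSemialgebraic_setOf_imp (A.hS.preimage_comp _)
      (soloInformed_isSemialgebraic_setOf_imp (A.hG.preimage_comp _)
      (soloInformed_isSemialgebraic_setOf_imp (B.hG.preimage_comp _)
      (soloInformed_isSemialgebraic_setOf_imp (soloInformed_isSemialgebraic_setOf_coord_le _ _)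
      (soloInformed_isSemialgebraic_setOf_imp (soloInformed_isSemialgebraic_setOf_coord_le _ _)
      (soloInformed_isSemialgebraic_setOf_imp (soloInformed_isSemialgebraic_setOf_coord_pos _)
      (soloInformed_isSemialgebraic_setOf_exists_block hM fun _ => Iff.rfl))))))
  refine soloInformed_isSemialgebraic_setOf_forall_fibre
    (soloInformed_isSemialgebraic_setOf_forall_block hO fun _ => Iff.rfl) fun p x => ?_
  simp only [mem_setOf_eq, Sum.elim_comp_inl, comp_snocIdx_mem_iff, comp_snocIdx₄_mem_iff,
    comp_snocIdx₂₄_mem_iff, Sum.elim_inl, Sum.elim_inr, mem_fibre]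

/-! ### The derivative clause (ε–δ, three blocks) -/

/-- `t ↦ F (x, t)` has derivative `g (x, t₀)` at every `t₀ ∈ (a x, b x)`, for `x ∈ D(A)`, ε–δ in
block form restricted to `(a x, b x)`: `w = (a x, b x, t₀, ε, g (x, t₀))`, `δ`,
`y = (s, F (x, s), F (x, t₀))`; absolute values as squares.
[cite: KontsevichZagier2001, §1.2 rule (3)] -/
def SoloInformedDerivClause (T W : SoloInformedPTerm K (d + 1)) (A B : SoloInformedPTerm K d)
    (p : K → ℝ) : Prop :=
  ∀ (x : Fin d → ℝ) (w : Fin 5 → ℝ), x ∈ A.fibre p → Fin.snoc x (w 0) ∈ A.gfibre p →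
    Fin.snoc x (w 1) ∈ B.gfibre p → w 0 < w 2 → w 2 < w 1 → 0 < w 3 →
      Fin.snoc (Fin.snoc x (w 2)) (w 4) ∈ T.gfibre p →
      ∃ δ : Fin 1 → ℝ, 0 < δ 0 ∧ ∀ y : Fin 3 → ℝ, w 0 < y 0 → y 0 < w 1 →
        (y 0 - w 2) ^ 2 < δ 0 ^ 2 → Fin.snoc (Fin.snoc x (y 0)) (y 1) ∈ W.gfibre p →
          Fin.snoc (Fin.snoc x (w 2)) (y 2) ∈ W.gfibre p →
            (y 1 - y 2 - w 4 * (y 0 - w 2)) ^ 2 ≤ w 3 ^ 2 * (y 0 - w 2) ^ 2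

/-- **The derivative clause is `ℚ`-semialgebraic.** [cite: BochnakCosteRoy1998, Prop. 2.2.4] -/
theorem isSemialgebraic_setOf_derivClause [Finite K] (T W : SoloInformedPTerm K (d + 1))
    (A B : SoloInformedPTerm K d) :
    IsSemialgebraic ℚ {p : K → ℝ | SoloInformedDerivClause T W A B p} := by
  let I : Set ((((K ⊕ Fin d) ⊕ Fin 5) ⊕ Fin 1) ⊕ Fin 3 → ℝ) := {u |
      u (Sum.inl (Sum.inl (Sum.inr 0))) < u (Sum.inr 0) →
      u (Sum.inr 0) < u (Sum.inl (Sum.inl (Sum.inr 1))) →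
      (u (Sum.inr 0) - u (Sum.inl (Sum.inl (Sum.inr 2)))) ^ 2 < u (Sum.inl (Sum.inr 0)) ^ 2 →
      u ∘ soloSnocIdx₄ K d 5 3 0 1 ∈ W.G → u ∘ soloSnocIdx₂₄ K d 5 3 2 2 ∈ W.G →
      (u (Sum.inr 1) - u (Sum.inr 2) - u (Sum.inl (Sum.inl (Sum.inr 4))) *
          (u (Sum.inr 0) - u (Sum.inl (Sum.inl (Sum.inr 2))))) ^ 2 ≤
        u (Sum.inl (Sum.inl (Sum.inr 3))) ^ 2 *
          (u (Sum.inr 0) - u (Sum.inl (Sum.inl (Sum.inr 2)))) ^ 2}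
  have hI : IsSemialgebraic ℚ I :=
    soloInformed_isSemialgebraic_setOf_imp (soloInformed_isSemialgebraic_setOf_coord_lt _ _)
      (soloInformed_isSemialgebraic_setOf_imp (soloInformed_isSemialgebraic_setOf_coord_lt _ _)
      (soloInformed_isSemialgebraic_setOf_imp (soloInformed_isSemialgebraic_setOf_sq_sub_lt _ _ _)
      (soloInformed_isSemialgebraic_setOf_imp (W.hG.preimage_comp _)
      (soloInformed_isSemialgebraic_setOf_imp (W.hG.preimage_comp _)
      (soloInformed_isSemialgebraic_setOf_derivIneq _ _ _ _ _ _)))))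
  let M : Set (((K ⊕ Fin d) ⊕ Fin 5) ⊕ Fin 1 → ℝ) :=
    {u | 0 < u (Sum.inr 0) ∧ ∀ y : Fin 3 → ℝ, Sum.elim u y ∈ I}
  have hM : IsSemialgebraic ℚ M :=
    soloInformed_isSemialgebraic_setOf_and (soloInformed_isSemialgebraic_setOf_coord_pos _)
      (soloInformed_isSemialgebraic_setOf_forall_block hI fun _ => Iff.rfl)
  have hO : IsSemialgebraic ℚ {u : (K ⊕ Fin d) ⊕ Fin 5 → ℝ | u ∘ Sum.inl ∈ A.S →
      u ∘ soloSnocIdx K d 5 0 ∈ A.G → u ∘ soloSnocIdx K d 5 1 ∈ B.G →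
      u (Sum.inr 0) < u (Sum.inr 2) → u (Sum.inr 2) < u (Sum.inr 1) → 0 < u (Sum.inr 3) →
      u ∘ soloSnocIdx₂ K d 5 2 4 ∈ T.G → ∃ δ : Fin 1 → ℝ, Sum.elim u δ ∈ M} :=
    soloInformed_isSemialgebraic_setOf_imp (A.hS.preimage_comp _)
      (soloInformed_isSemialgebraic_setOf_imp (A.hG.preimage_comp _)
      (soloInformed_isSemialgebraic_setOf_imp (B.hG.preimage_comp _)
      (soloInformed_isSemialgebraic_setOf_imp (soloInformed_isSemialgebraic_setOf_coord_lt _ _)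
      (soloInformed_isSemialgebraic_setOf_imp (soloInformed_isSemialgebraic_setOf_coord_lt _ _)
      (soloInformed_isSemialgebraic_setOf_imp (soloInformed_isSemialgebraic_setOf_coord_pos _)
      (soloInformed_isSemialgebraic_setOf_imp (T.hG.preimage_comp _)
      (soloInformed_isSemialgebraic_setOf_exists_block hM fun _ => Iff.rfl)))))))
  refine soloInformed_isSemialgebraic_setOf_forall_fibre
    (soloInformed_isSemialgebraic_setOf_forall_block hO fun _ => Iff.rfl) fun p x => ?_
  simp only [M, I, mem_setOf_eq, Sum.elim_comp_inl, comp_snocIdx_mem_iff, comp_snocIdx₂_mem_iff,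
    comp_snocIdx₄_mem_iff, comp_snocIdx₂₄_mem_iff, Sum.elim_inl, Sum.elim_inr, mem_fibre]

end SoloInformedPTerm

end Summit.KontsevichZagierPeriods.KontsevichZagierPeriods.Theorems
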